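import Literature.AlgebraicGeometry.Motives.MixedHodgeStructureHodgeNumbersAdditive
import Literature.AlgebraicGeometry.Motives.MixedHodgeStructureDeligneSplittingUnique
import HarnessLib

/-!
# The Deligne grading `Y_{(F,W)}` of a mixed Hodge structure

"Let `L` be an increasing filtration of `V` indexed by `ℤ`. Then, a grading of `L` is a semisimple
endomorphism `Y` of `V` such that `L_k = ⊕_{i ≤ k} E_i(Y)`" and "the associated Deligne grading `Y_{(F,W)}`
of `W` is the semisimple endomorphism of `V_ℂ` which acts as multiplication by `p + q` on `I^{p,q}`"
(Brosnan–Pearlstein, §2.1). This file defines, for a mixed Hodge structure `H` on a finite-dimensional `V`,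

* `MixedHodgeStructure.deligneProj H pq` — the projection of `V_ℂ` onto `I^{pq}` along `⊕_{rs ≠ pq} I^{rs}`
  (`V_ℂ = ⊕ I^{p,q}`, Cattani et al., Prop. 3.2.19), with `isCompl_deligneFamily`, `deligneProj_apply_of_mem`,
  `deligneProj_apply_of_mem_ne`, `deligneProj_apply_mem`, **`sum_deligneProj_apply`** (`Σ_{p,q} π_{p,q} = id`);
* **`MixedHodgeStructure.deligneY H : V_ℂ →ₗ[ℂ] V_ℂ`**, `Y = Σ (p+q) π_{p,q}`, with **`deligneY_apply_of_mem`**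
  (`Y x = (p+q) x` on `I^{p,q}`), `map_deligneY_baseChange_W_le` (`Y` preserves `W`),
  `deligneY_sub_smul_mem_baseChange_W_pred` (`Y ≡ n` on `Gr^W_n`: `Y` is a grading of `W`),
  `deligneY_apply_of_mem_biSup`, `map_deligneY_F_le` (`Y` preserves `F`), `linearMap_eq_of_eqOn_deligneI`,
  and the `complexConj`-symmetry for `ℝ`-split structures (`conj_deligneY_apply_of_forall`).
* §3 functoriality `Hom.baseChange_comp_deligneY` (`f ∘ Y₁ = Y₂ ∘ f`), `deligneProj_comp_deligneY`,
  `biSup_deligneFamily_inf_biSup`, the eigenspaces **`deligneY_apply_eq_smul_iff`**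
  (`E_n(Y) = ⊕_{p+q=n} I^{p,q}`), and **`complexConj_deligneI_eq_of_conj_deligneY`** (Brosnan–Pearlstein
  Lemma 2.1.4 (c) ⇒ (a): `Y` real ⇒ split over `ℝ`, via the congruence (7.5.11)).

Everything is proved; no named fact is introduced.

## References

* [BrosnanPearlstein2009Duke] P. Brosnan, G. Pearlstein, *Zero loci of admissible normal functions with
  torsion singularities*, Duke Math. J. 150 (2009), §2.1 ("grading of `L`", "Deligne grading `Y_{(F,W)}`",
  Lemma 2.1.4 (c)).
* [CattaniElZeinGriffithsLe2014] E. Cattani et al. (eds.), *Hodge Theory* (2014), Prop. 3.2.19, Thm. 7.5.6.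
-/

noncomputable section

open scoped TensorProduct

namespace Literature.AlgebraicGeometry.Motives

namespace MixedHodgeStructure

open HodgeStructure (conj complexConj mem_complexConj)

universe u

variable {V : Type u} [AddCommGroup V] [Module ℚ V] (H : MixedHodgeStructure V)

/-! ## §1 The projections onto Deligne's pieces -/

/-- **`I^{p,q}` and `⊕_{(r,s) ≠ (p,q)} I^{r,s}` are complementary** (`V_ℂ = ⊕_{p,q} I^{p,q}`, Prop. 3.2.19).
[cite: CattaniElZeinGriffithsLe2014, Prop. 3.2.19] -/
theorem isCompl_deligneFamily (pq : ℤ × ℤ) :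
    IsCompl (H.deligneFamily pq) (⨆ rs ∈ {rs : ℤ × ℤ | rs ≠ pq}, H.deligneFamily rs) :=
  ⟨H.iSupIndep_deligneFamily pq, by
    rw [codisjoint_iff, ← H.iSup_deligneFamily_eq_top, iSup_split_single H.deligneFamily pq]
    rfl⟩

/-- **The projection `π_{p,q} : V_ℂ → V_ℂ` onto `I^{p,q}` along `⊕_{(r,s) ≠ (p,q)} I^{r,s}`.**
[cite: CattaniElZeinGriffithsLe2014, Prop. 3.2.19] -/
def deligneProj (pq : ℤ × ℤ) : (ℂ ⊗[ℚ] V) →ₗ[ℂ] (ℂ ⊗[ℚ] V) :=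
  (H.deligneFamily pq).projection (⨆ rs ∈ {rs : ℤ × ℤ | rs ≠ pq}, H.deligneFamily rs)
    (H.isCompl_deligneFamily pq)

/-- `π_{p,q} x = x` for `x ∈ I^{p,q}`. [cite: CattaniElZeinGriffithsLe2014, Prop. 3.2.19] -/
theorem deligneProj_apply_of_mem {pq : ℤ × ℤ} {x : ℂ ⊗[ℚ] V} (hx : x ∈ H.deligneFamily pq) :
    H.deligneProj pq x = x :=
  Submodule.projection_apply_of_mem_left _ hx

/-- `π_{p,q} x = 0` for `x ∈ I^{r,s}`, `(r,s) ≠ (p,q)`. [cite: CattaniElZeinGriffithsLe2014, Prop. 3.2.19] -/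
theorem deligneProj_apply_of_mem_ne {pq rs : ℤ × ℤ} (h : rs ≠ pq) {x : ℂ ⊗[ℚ] V}
    (hx : x ∈ H.deligneFamily rs) : H.deligneProj pq x = 0 := by
  have hle : H.deligneFamily rs ≤ ⨆ rs ∈ {rs : ℤ × ℤ | rs ≠ pq}, H.deligneFamily rs :=
    le_iSup₂_of_le rs h le_rfl
  exact Submodule.projection_apply_of_mem_right _ (hle hx)

/-- `π_{p,q} x ∈ I^{p,q}`. [cite: CattaniElZeinGriffithsLe2014, Prop. 3.2.19] -/
theorem deligneProj_apply_mem (pq : ℤ × ℤ) (x : ℂ ⊗[ℚ] V) : H.deligneProj pq x ∈ H.deligneFamily pq :=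
  Submodule.projection_apply_mem _ x

/-- `π_{p,q} = 0` when `I^{p,q} = 0`. [cite: CattaniElZeinGriffithsLe2014, Prop. 3.2.19] -/
theorem deligneProj_eq_zero_of_eq_bot {pq : ℤ × ℤ} (h : H.deligneFamily pq = ⊥) : H.deligneProj pq = 0 := by
  refine LinearMap.ext fun x => ?_
  have hx := H.deligneProj_apply_mem pq x
  rw [h, Submodule.mem_bot] at hx
  rw [hx, LinearMap.zero_apply]

variable [FiniteDimensional ℚ V]

/-- **`Σ_{p,q} π_{p,q} = id`** (sum over the finitely many nonzero pieces): every vector is the sum of its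
Deligne components. [cite: CattaniElZeinGriffithsLe2014, Prop. 3.2.19] -/
theorem sum_deligneProj_apply (x : ℂ ⊗[ℚ] V) :
    ∑ pq ∈ H.finite_setOf_deligneFamily_ne_bot.toFinset, H.deligneProj pq x = x := by
  have hx : x ∈ ⨆ pq, H.deligneFamily pq := by rw [H.iSup_deligneFamily_eq_top]; exact Submodule.mem_top
  induction hx using Submodule.iSup_induction' with
  | mem t x hxt =>
    by_cases ht : t ∈ H.finite_setOf_deligneFamily_ne_bot.toFinset
    · rw [Finset.sum_eq_single t (fun pq _ hpt => H.deligneProj_apply_of_mem_ne (Ne.symm hpt) hxt)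
        (fun h => (h ht).elim), H.deligneProj_apply_of_mem hxt]
    · rw [Set.Finite.mem_toFinset, Set.mem_setOf_eq, not_not] at ht
      rw [ht, Submodule.mem_bot] at hxt
      simp [hxt]
  | zero => simp
  | add x y _ _ hx hy => simp only [map_add, Finset.sum_add_distrib, hx, hy]

/-! ## §2 The Deligne grading `Y` -/

/-- **The Deligne grading `Y = Y_{(F,W)} := Σ_{p,q} (p + q) π_{p,q}`** — "the semisimple endomorphism of
`V_ℂ` which acts as multiplication by `p + q` on `I^{p,q}`" (Brosnan–Pearlstein, §2.1).
[cite: BrosnanPearlstein2009Duke, §2.1 (Deligne grading `Y_{(F,W)}`)] -/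
def deligneY : (ℂ ⊗[ℚ] V) →ₗ[ℂ] (ℂ ⊗[ℚ] V) :=
  ∑ pq ∈ H.finite_setOf_deligneFamily_ne_bot.toFinset, ((pq.1 + pq.2 : ℤ) : ℂ) • H.deligneProj pq

/-- **`Y x = (p + q) · x` for `x ∈ I^{p,q}`.** [cite: BrosnanPearlstein2009Duke, §2.1 (Deligne grading `Y_{(F,W)}`)] -/
theorem deligneY_apply_of_mem {p q : ℤ} {x : ℂ ⊗[ℚ] V} (hx : x ∈ H.deligneI p q) :
    H.deligneY x = ((p + q : ℤ) : ℂ) • x := by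
  have hx' : x ∈ H.deligneFamily (p, q) := hx
  rw [deligneY, LinearMap.sum_apply]
  by_cases ht : (p, q) ∈ H.finite_setOf_deligneFamily_ne_bot.toFinset
  · rw [Finset.sum_eq_single (p, q) (fun pq _ hpt => by
        rw [LinearMap.smul_apply, H.deligneProj_apply_of_mem_ne (Ne.symm hpt) hx', smul_zero])
      (fun h => (h ht).elim), LinearMap.smul_apply, H.deligneProj_apply_of_mem hx']
  · rw [Set.Finite.mem_toFinset, Set.mem_setOf_eq, not_not] at ht
    rw [ht, Submodule.mem_bot] at hx'
    subst hx'
    simp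

/-- `Y` maps `I^{p,q}` into itself. [cite: BrosnanPearlstein2009Duke, §2.1 (Deligne grading `Y_{(F,W)}`)] -/
theorem deligneY_apply_mem_of_mem {p q : ℤ} {x : ℂ ⊗[ℚ] V} (hx : x ∈ H.deligneI p q) :
    H.deligneY x ∈ H.deligneI p q := by
  rw [H.deligneY_apply_of_mem hx]
  exact Submodule.smul_mem _ _ hx

omit [FiniteDimensional ℚ V] in
/-- A linear identity holds on all of `V_ℂ` once it holds on each `I^{p,q}` (`V_ℂ = ⊕ I^{p,q}`).
[cite: CattaniElZeinGriffithsLe2014, Prop. 3.2.19] -/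
theorem linearMap_eq_of_eqOn_deligneI {M : Type*} [AddCommGroup M] [Module ℂ M] {f g : (ℂ ⊗[ℚ] V) →ₗ[ℂ] M}
    (h : ∀ p q : ℤ, ∀ x ∈ H.deligneI p q, f x = g x) : f = g := by
  refine LinearMap.ext fun x => ?_
  have hx : x ∈ ⨆ pq, H.deligneFamily pq := by rw [H.iSup_deligneFamily_eq_top]; exact Submodule.mem_top
  induction hx using Submodule.iSup_induction' with
  | mem pq x hx => exact h pq.1 pq.2 x hx
  | zero => simp
  | add x y _ _ hx hy => rw [map_add, map_add, hx, hy]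

/-- **`Y` is a grading of `W`: `Y` preserves each `W_{n,ℂ} = ⊕_{p+q ≤ n} I^{p,q}`.**
[cite: BrosnanPearlstein2009Duke, §2.1 ("grading of `L`")] -/
theorem map_deligneY_baseChange_W_le (n : ℤ) :
    ((H.W n).baseChange ℂ).map H.deligneY ≤ (H.W n).baseChange ℂ := by
  rw [Submodule.map_le_iff_le_comap, H.baseChange_W_eq_biSup_deligneFamily n]
  refine iSup₂_le fun pq hpq x hx => ?_
  rw [Submodule.mem_comap]
  exact (le_iSup₂_of_le pq hpq le_rfl : H.deligneFamily pq ≤ _) (H.deligneY_apply_mem_of_mem hx)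

/-- **`Y` induces multiplication by `n` on `Gr^W_n`: `Y x - n·x ∈ W_{n-1,ℂ}` for `x ∈ W_{n,ℂ}`** — with
`map_deligneY_baseChange_W_le`, this says `W_n = ⊕_{i ≤ n} E_i(Y)`, i.e. `Y` is a grading of `W` in the
sense of Brosnan–Pearlstein §2.1. [cite: BrosnanPearlstein2009Duke, §2.1 ("grading of `L`")] -/
theorem deligneY_sub_smul_mem_baseChange_W_pred {n : ℤ} {x : ℂ ⊗[ℚ] V} (hx : x ∈ (H.W n).baseChange ℂ) :
    H.deligneY x - (n : ℂ) • x ∈ (H.W (n - 1)).baseChange ℂ := by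
  rw [H.baseChange_W_eq_biSup_deligneFamily n] at hx
  induction hx using Submodule.iSup_induction' with
  | mem pq x hx =>
    induction hx using Submodule.iSup_induction' with
    | mem hpq x hx =>
      rw [H.deligneY_apply_of_mem (show x ∈ H.deligneI pq.1 pq.2 from hx), ← sub_smul]
      rcases lt_or_eq_of_le hpq with hlt | heq
      · exact Submodule.smul_mem _ _ ((H.deligneI_le_W pq.1 pq.2).trans
          (Submodule.baseChange_mono ℂ (H.monotone_W (by omega))) hx)
      · rw [heq, sub_self, zero_smul]
        exact Submodule.zero_mem _
    | zero => simp
    | add x y _ _ hx hy =>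
      rw [map_add, smul_add, add_sub_add_comm]
      exact Submodule.add_mem _ hx hy
  | zero => simp
  | add x y _ _ hx hy =>
    rw [map_add, smul_add, add_sub_add_comm]
    exact Submodule.add_mem _ hx hy

/-- `Y x = n · x` on `⊕_{p+q = n} I^{p,q}` (the `n`-eigenspace contains the weight-`n` pieces).
[cite: BrosnanPearlstein2009Duke, §2.1 (Deligne grading `Y_{(F,W)}`)] -/
theorem deligneY_apply_of_mem_biSup {n : ℤ} {x : ℂ ⊗[ℚ] V}
    (hx : x ∈ ⨆ pq ∈ {pq : ℤ × ℤ | pq.1 + pq.2 = n}, H.deligneFamily pq) : H.deligneY x = (n : ℂ) • x := by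
  induction hx using Submodule.iSup_induction' with
  | mem pq x hx =>
    induction hx using Submodule.iSup_induction' with
    | mem hpq x hx =>
      rw [H.deligneY_apply_of_mem (show x ∈ H.deligneI pq.1 pq.2 from hx)]
      rw [Set.mem_setOf_eq] at hpq
      rw [hpq]
    | zero => simp
    | add x y _ _ hx hy => rw [map_add, hx, hy, smul_add]
  | zero => simp
  | add x y _ _ hx hy => rw [map_add, hx, hy, smul_add]

/-- **`Y` preserves the Hodge filtration `F^p = ⊕_{a ≥ p} I^{a,b}`.** [cite: BrosnanPearlstein2009Duke, §2.1 Lemma 2.1.4 (c)] -/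
theorem map_deligneY_F_le (p : ℤ) : (H.F p).map H.deligneY ≤ H.F p := by
  rw [Submodule.map_le_iff_le_comap, H.F_eq_biSup_deligneFamily p]
  refine iSup₂_le fun pq hpq x hx => ?_
  rw [Submodule.mem_comap]
  exact (le_iSup₂_of_le pq hpq le_rfl : H.deligneFamily pq ≤ _) (H.deligneY_apply_mem_of_mem hx)

/-- **For an `ℝ`-split MHS (`conj I^{p,q} = I^{q,p}`) the Deligne grading is REAL: `conj (Y x) = Y (conj x)`**
(one direction of Brosnan–Pearlstein, Lemma 2.1.4 (a) ⇒ (c)). [cite: BrosnanPearlstein2009Duke, §2.1 Lemma 2.1.4] -/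
theorem conj_deligneY_apply_of_forall (h : ∀ p q : ℤ, complexConj (H.deligneI p q) = H.deligneI q p)
    (x : ℂ ⊗[ℚ] V) : conj (H.deligneY x) = H.deligneY (conj x) := by
  have hx : x ∈ ⨆ pq, H.deligneFamily pq := by rw [H.iSup_deligneFamily_eq_top]; exact Submodule.mem_top
  induction hx using Submodule.iSup_induction' with
  | mem pq x hx =>
    have hcx : conj x ∈ H.deligneI pq.2 pq.1 := by
      rw [← h pq.1 pq.2, mem_complexConj, HodgeStructure.conj_conj]
      exact hx
    rw [H.deligneY_apply_of_mem (show x ∈ H.deligneI pq.1 pq.2 from hx), H.deligneY_apply_of_mem hcx,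
      HodgeStructure.conj_smul, add_comm pq.2 pq.1]
    congr 1
    exact map_intCast (starRingEnd ℂ) _
  | zero => simp
  | add x y _ _ hx hy => rw [map_add, map_add, map_add, hx, hy, map_add]

/-! ## §3 Functoriality, the eigenspaces `E_n(Y) = ⊕_{p+q=n} I^{p,q}`, and "`Y` real ⇒ split over `ℝ`" -/

/-- **Morphisms of mixed Hodge structures commute with the Deligne gradings: `f ∘ Y₁ = Y₂ ∘ f`**
(`f I^{p,q} ⊆ I^{p,q}`, the functoriality of `I^{•,•}`). [cite: BrosnanPearlstein2009Duke, §2.1 ("unique, functorial bigrading")] -/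
theorem Hom.baseChange_comp_deligneY {V' : Type u} [AddCommGroup V'] [Module ℚ V'] [FiniteDimensional ℚ V']
    {H₁ : MixedHodgeStructure V} {H₂ : MixedHodgeStructure V'} (f : Hom H₁ H₂) :
    f.toLinearMap.baseChange ℂ ∘ₗ H₁.deligneY = H₂.deligneY ∘ₗ f.toLinearMap.baseChange ℂ := by
  refine H₁.linearMap_eq_of_eqOn_deligneI fun p q x hx => ?_
  have hfx : f.toLinearMap.baseChange ℂ x ∈ H₂.deligneI p q := f.map_deligneI_le p q ⟨x, hx, rfl⟩
  rw [LinearMap.comp_apply, LinearMap.comp_apply, H₁.deligneY_apply_of_mem hx, H₂.deligneY_apply_of_mem hfx,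
    map_smul]

/-- `π_{p,q} ∘ Y = (p + q) · π_{p,q}`. [cite: BrosnanPearlstein2009Duke, §2.1 (Deligne grading `Y_{(F,W)}`)] -/
theorem deligneProj_comp_deligneY (pq : ℤ × ℤ) :
    H.deligneProj pq ∘ₗ H.deligneY = ((pq.1 + pq.2 : ℤ) : ℂ) • H.deligneProj pq := by
  refine H.linearMap_eq_of_eqOn_deligneI fun p q x hx => ?_
  rw [LinearMap.comp_apply, LinearMap.smul_apply, H.deligneY_apply_of_mem hx, map_smul]
  by_cases h : (p, q) = pq
  · subst h
    rfl
  · rw [H.deligneProj_apply_of_mem_ne h hx, smul_zero, smul_zero]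

omit [FiniteDimensional ℚ V] in
/-- **Sums of Deligne pieces intersect along the index sets: `(⊕_S I) ∩ (⊕_{S'} I) = ⊕_{S ∩ S'} I`**
(`V_ℂ = ⊕ I^{p,q}` is a direct sum). [cite: CattaniElZeinGriffithsLe2014, Prop. 3.2.19] -/
theorem biSup_deligneFamily_inf_biSup (S S' : Set (ℤ × ℤ)) :
    (⨆ pq ∈ S, H.deligneFamily pq) ⊓ (⨆ pq ∈ S', H.deligneFamily pq) = ⨆ pq ∈ S ∩ S', H.deligneFamily pq := by
  refine le_antisymm ?_ (le_inf (biSup_mono fun i hi => hi.1) (biSup_mono fun i hi => hi.2))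
  have hS : (⨆ pq ∈ S, H.deligneFamily pq) =
      (⨆ pq ∈ S ∩ S', H.deligneFamily pq) ⊔ ⨆ pq ∈ S \ S', H.deligneFamily pq := by
    rw [← iSup_union, Set.inter_union_sdiff]
  have hdisj : Disjoint (⨆ pq ∈ S \ S', H.deligneFamily pq) (⨆ pq ∈ S', H.deligneFamily pq) :=
    H.iSupIndep_deligneFamily.disjoint_biSup_biSup (Set.disjoint_left.2 fun i hi hi' => hi.2 hi')
  have hle : (⨆ pq ∈ S ∩ S', H.deligneFamily pq) ≤ ⨆ pq ∈ S', H.deligneFamily pq :=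
    biSup_mono fun i hi => hi.2
  rw [hS, sup_inf_assoc_of_le _ hle, hdisj.eq_bot, sup_bot_eq]

/-- **The eigenspaces of the Deligne grading: `Y x = n·x ↔ x ∈ ⊕_{p+q=n} I^{p,q}`** (`E_n(Y) = ⊕_{p+q=n} I^{p,q}`;
`Y` is semisimple with `W_k = ⊕_{i ≤ k} E_i(Y)`). [cite: BrosnanPearlstein2009Duke, §2.1 ("grading of `L`", `E_i(Y)`)] -/
theorem deligneY_apply_eq_smul_iff (n : ℤ) (x : ℂ ⊗[ℚ] V) :
    H.deligneY x = (n : ℂ) • x ↔ x ∈ ⨆ pq ∈ {pq : ℤ × ℤ | pq.1 + pq.2 = n}, H.deligneFamily pq := by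
  refine ⟨fun h => ?_, fun h => H.deligneY_apply_of_mem_biSup h⟩
  -- every component of `x` off the weight-`n` line vanishes
  have hproj : ∀ pq : ℤ × ℤ, pq.1 + pq.2 ≠ n → H.deligneProj pq x = 0 := by
    intro pq hpq
    have h1 : H.deligneProj pq (H.deligneY x) = ((pq.1 + pq.2 : ℤ) : ℂ) • H.deligneProj pq x :=
      LinearMap.congr_fun (H.deligneProj_comp_deligneY pq) x
    rw [h, map_smul] at h1
    have h2 : (((pq.1 + pq.2 : ℤ) : ℂ) - (n : ℂ)) • H.deligneProj pq x = 0 := by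
      rw [sub_smul, ← h1, sub_self]
    rcases smul_eq_zero.1 h2 with h3 | h3
    · exfalso
      apply hpq
      exact_mod_cast sub_eq_zero.1 h3
    · exact h3
  rw [← H.sum_deligneProj_apply x]
  refine Submodule.sum_mem _ fun pq _ => ?_
  by_cases hpq : pq.1 + pq.2 = n
  · exact (le_iSup₂_of_le pq hpq le_rfl : H.deligneFamily pq ≤ _) (H.deligneProj_apply_mem pq x)
  · rw [hproj pq hpq]
    exact Submodule.zero_mem _

/-- **Brosnan–Pearlstein, Lemma 2.1.4 ((c) ⇒ (a)): if the Deligne grading is REAL (`conj ∘ Y = Y ∘ conj`),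
the mixed Hodge structure is split over `ℝ` (`conj I^{p,q} = I^{q,p}`)** — `conj I^{p,q}` lies in the
eigenspace `E_{p+q}(Y) = ⊕_{r+s=p+q} I^{r,s}` and in `I^{q,p} ⊕ ⊕_{r<q,s<p} I^{r,s}` (the congruence (7.5.11),
the tree's `complexConj_deligneI_le_deligneI_sup_biSup`), whose intersection is `I^{q,p}`. Together with
`conj_deligneY_apply_of_forall` this is the equivalence (a) ⇔ (c) of Lemma 2.1.4 for `Y = Y_{(F,W)}`.
[cite: BrosnanPearlstein2009Duke, §2.1 Lemma 2.1.4] [cite: CattaniElZeinGriffithsLe2014, Thm. 7.5.6 (7.5.11)] -/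
theorem complexConj_deligneI_eq_of_conj_deligneY (hY : ∀ x : ℂ ⊗[ℚ] V, conj (H.deligneY x) = H.deligneY (conj x))
    (p q : ℤ) : complexConj (H.deligneI p q) = H.deligneI q p := by
  -- `conj I^{p,q} ≤ I^{q,p}` for all `p q` suffices (apply it twice)
  have key : ∀ p q : ℤ, complexConj (H.deligneI p q) ≤ H.deligneI q p := by
    intro p q y hy
    rw [mem_complexConj] at hy
    -- `y = conj (conj y)` with `conj y ∈ I^{p,q}`
    have hyE : y ∈ ⨆ pq ∈ {pq : ℤ × ℤ | pq.1 + pq.2 = q + p}, H.deligneFamily pq := by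
      rw [← H.deligneY_apply_eq_smul_iff]
      have h1 := hY (conj y)
      rw [H.deligneY_apply_of_mem hy, HodgeStructure.conj_smul, HodgeStructure.conj_conj, map_intCast] at h1
      rw [← h1, add_comm q p]
    have hyC : y ∈ H.deligneI q p ⊔ ⨆ pq ∈ {pq : ℤ × ℤ | pq.1 < q ∧ pq.2 < p}, H.deligneFamily pq := by
      refine H.complexConj_deligneI_le_deligneI_sup_biSup q p ?_
      rw [mem_complexConj]
      exact hy
    have hsum : H.deligneI q p ⊔ ⨆ pq ∈ {pq : ℤ × ℤ | pq.1 < q ∧ pq.2 < p}, H.deligneFamily pq =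
        ⨆ pq ∈ ({(q, p)} : Set (ℤ × ℤ)) ∪ {pq : ℤ × ℤ | pq.1 < q ∧ pq.2 < p}, H.deligneFamily pq := by
      rw [iSup_union, iSup_singleton, deligneFamily_apply]
    rw [hsum] at hyC
    have hmem := Submodule.mem_inf.2 ⟨hyE, hyC⟩
    rw [biSup_deligneFamily_inf_biSup] at hmem
    have hS : {pq : ℤ × ℤ | pq.1 + pq.2 = q + p} ∩ (({(q, p)} : Set (ℤ × ℤ)) ∪ {pq : ℤ × ℤ | pq.1 < q ∧ pq.2 < p}) =
        {(q, p)} := by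
      ext pq
      simp only [Set.mem_inter_iff, Set.mem_setOf_eq, Set.mem_union, Set.mem_singleton_iff, Prod.ext_iff]
      constructor
      · rintro ⟨h1, h2 | h2⟩
        · exact h2
        · omega
      · rintro ⟨h1, h2⟩
        exact ⟨by rw [h1, h2], Or.inl ⟨h1, h2⟩⟩
    rw [hS, iSup_singleton] at hmem
    exact hmem
  refine le_antisymm (key p q) fun y hy => ?_
  rw [mem_complexConj]
  have h := key q p (show conj y ∈ complexConj (H.deligneI q p) by
    rw [mem_complexConj, HodgeStructure.conj_conj]; exact hy)
  exact h

end MixedHodgeStructure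

end Literature.AlgebraicGeometry.Motives

end
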